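import Literature.MathematicalPhysics.QuantumFieldTheory.Balaban1983to89.B6
import Literature.MathematicalPhysics.QuantumFieldTheory.Balaban1983to89.B5Prop12GHolds

/-!
# `Balaban1983to89.B6Prop26OneScaleFromB5` — [B6] **Proposition 2.6 ON THE ONE-LEVEL SUB-FAMILY IS [4]'s
# Proposition 1.2**: the VERBATIM typed `B6.Prop26Printed` INHABITED, HYPOTHESIS-FREE, by the unit-lattice tori of
# record of [B5] carrying Bałaban's `G = Δ_a⁻¹` (transfer from p37's `B5Prop12GHolds.prop12_famG_printed`)

FRAMING (verbatim cell line):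
statement-level skeleton of published theorems with citation tags; proofs where landed; nothing here is a claim about the Yang–Mills mass gap

Sources (cell `lit-balaban`, HOME `run/shared/lean/pub/lit-balaban/`; seat **r03 gen 9** = the B6 fold owner; SKELETON
rows **B6.Prop2.6** (this file) and B5.Prop1.2 (input, owner r02, proved p302056)): T. Bałaban, *Propagators and
renormalization transformations for lattice gauge theories. II*, Commun. Math. Phys. **96** (1984) 223–250
[`Balaban1984PropagatorsII`, "B6"], held `paper:balaban1984-cmp96-propagators-rt-ii` (journal page = PDF page + 222;
p. 223 [PDF 1] read from the text layer this session, p. 247 [PDF 25] from the render-checked transcription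
`pub-balaban/b2b-balaban-r1/B6.md` and the verbatim docstring of `…B6.Prop26Printed`); T. Bałaban, *… I*, Commun.
Math. Phys. **95** (1984) 17–40 [`Balaban1984PropagatorsI`, "[4]" of B6 = cell paper B5], Prop. 1.2 pp. 35–36,
(1.69)–(1.71) p. 29 (verbatim docstring of `…B5.Prop12Printed`, transcription `b2b-balaban-r1/B5.md`).

## WHAT IS PRINTED (verbatim up to notation)

[B6] p. 223: «We continue the studies of the Paper I and extend the results of this paper to operators defined by
restrictions on different scales … This paper is a continuation of [4] and we use all the notations introduced there
without further explanation. … a distance between two points x, y ∈ ηZ^d … is given by the l¹-norm of the vector x − y».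
p. 224: the geometry (2.1)–(2.4), Ω₁ ⊃ Ω₂ ⊃ … ⊃ Ω_k, Λ_j = Ω_j^{(j)} ∖ B(Ω_{j+1}^{(j+1)}), 𝔅 = ⋃_j Λ_j; p. 225–226:
(QA)(b) = (Q_jA)(b) for b ∈ Λ_j (2.20), Δ_a = ∂*∂ + ∂R∂* + Q*aQ = Δ − ∂P∂* + Q*aQ (2.19), R = I − P the orthogonal
projection onto Δ′_aN(Q′) = ΔN(Q′) (2.17), G = Δ_a⁻¹ (2.22).  [4] p. 29: Δ_a = ∂*∂ + ∂R∂* + aQ*Q = Δ − ∂P∂* + aQ*Q,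
R = I − P (1.69), P the projection (1.70), G = G_k = Δ_a⁻¹ (1.71).
[B6] p. 247, Proposition 2.6: «There exists a positive constant δ₃ depending on d and L only, such that |(GJ)(x)|,
|(∇GJ)(x)|, |(G∇*J)(x)|, |(ΔGJ)(x)| ≤ O(1)[(L^jη)², L^jη, L^jη, 1]e^{−δ₃d(y,y′)}|J| (2.136) for x ∈ Δ(y), y ∈ Λ_j,
supp J ⊂ Δ(y′) … [(2.137)–(2.140)] …».  [4] pp. 35–36, Proposition 1.2: «There exists a positive constant δ₀ depending
on d only, such that |(GJ)(x)|, |(∇GJ)(x)|, |(G∇*J)(x)|, |(ΔGJ)(x)| ≤ O(1)e^{−δ₀|y−y′|}|J| (1.110) for x ∈ Δ̃(y),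
supp J ⊂ Δ̃(y′) … [(1.111)–(1.114)]».  The two displays (2.136)–(2.140) and (1.110)–(1.114) have the same five shapes;
(2.136)–(2.140) carry the scale prefactors (L^jη)², L^jη, (L^jη)^{1−α}, (L^jη)^{−α}, [(L^jη)², L^jη, L^jη, 1, 1, 1] and the
multi-scale distance d(y, y′) of (2.46) in place of |y − y′| (cf. the tree's verbatim typings `…B6.Ineq2136_2140` over
`…B6.GFamily` and `…B5.Ineq110_114` over `…B5.Setting`, which differ exactly by `B6.pref4`/`B6.pref6`/the two rpow
prefactors).

## WHAT THIS FILE PROVES (kernel-checked; 0 sorry; no new `def … : Prop`; the B5 lineage is USED, not re-proved)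

* §1 DICTIONARY.  A `B5.Setting` `S` with a finite site type is read as a ONE-LEVEL `B6.Geometry` `geoOf S dist L K M`
  (all sites at scale `K`, `η = (L^K)⁻¹`, so `L^jη = len y = 1` for every y — `len_geoOf`; (2.1)–(2.2) void at one level:
  `Hyp21_22 := True`; the test-function/cut-off data copied) and its functionals as a `B6.GFamily` `gOf S …` (e, h1, e4,
  h2, l2 := S.e, S.h1, S.e4, S.h2, S.l2loc).  **`ineq2136_of_ineq110`**: `B5.Ineq110_114 S C Cα Cε Cαε δ₀` ⟹
  `B6.Ineq2136_2140 (gOf S …) C Cα⁺ Cε⁺ Cαε⁺ (δ₀/κ)` for ANY distance `dist ≤ κ·S.dist` (`Cα⁺ = max(Cα, 0)` etc.), given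
  the non-negativity of the four norm functionals; `pref4_one`/`pref6_one`/`Real.one_rpow` remove the prefactors.
  **`prop26Printed_of_prop12Printed`**: `B5.Prop12Printed fam` ⟹ `B6.Prop26Printed` for the one-level geometries of the
  family (M₁ := 1 ≤ M := 1).
* §2 THE INSTANCE.  On p38/r02's family of record `B5Prop12GLattice.famG d L a : TopIdx d L → B5.Setting` ([B5]'s
  top-level tori `T_η`, η = L^{−K}, every volume, `G = Δ_a⁻¹ = (B5DeltaA169.DeltaA n M a)⁻¹` of [4] (1.69)–(1.71) seen through the genuine
  functionals `eL`/`h1L`/`e4L`/`h2L`/`l2locL` of `B5Prop12FieldsLattice`), with B6's one-level distance `dist1` = the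
  ℓ¹ circular distance on `T₁^{(K)}` (p. 223; `dist1_le`: ℓ¹ ≤ d·sup): **`prop26Printed_famG (hd : 1 ≤ d)
  (hL : Odd L ∧ 1 < L) (ha : 0 < a) : B6.Prop26Printed (geoFam d L a) (GFam d L a)`** from p37's
  `B5Prop12GHolds.prop12_famG_printed` BY NAME, δ₃ = δ₀/d; the guard-free per-member form **`ineq2136_2140_famG`**;
  the guards of `Prop26Printed` are met by every member (`guards_geoFam`) and the index type is inhabited
  (`topIdx_nonempty`), so the instance is NOT vacuous.

## HONEST SCOPE

ONE LEVEL ONLY: the members are the geometries (2.1)–(2.4) with Ω₁ = … = Ω_K = T_η, Λ_j = ∅ (j < K), Λ_K = T₁^{(K)}, on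
which (2.20) reads Q = Q_K, (2.17) and [4] (1.70) are both the orthogonal projection onto ΔN(Q′_K), and Δ_a of (2.19)
IS Δ_a of [4] (1.69) — a READING of the two prints (p. 223 «continuation of [4] … same notations»), recorded here, not a
Lean statement: the Lean content is that [4]'s Prop. 1.2 functionals of [4]'s G on the tori of record inhabit B6's
verbatim Prop. 2.6 typing.  At one level L^jη = 1 (unit lattice of [4]), every prefactor of (2.136)–(2.140) equals 1,
the multi-scale distance (2.46) is the ℓ¹ unit-lattice distance (`dist1`), and the instance is stated with [4]'s doubled
cubes Δ̃ (x ∈ Δ̃(y) ⊇ Δ(y), supp J ⊂ Δ̃(y′) ⊇ Δ(y′): a formally STRONGER reading of (2.136)/(2.140)).  The Hölder-norm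
scale ξ = L^{−j} of (2.137)/(2.139) is [4]'s (unit lattice).  Constants: δ₃ = δ₀/d and O(1)⁺ = max(O(1), 0) of [4]'s
(existential there: p37/p38/r02/p16's chain).  The MULTI-LEVEL statement (k ≥ 2 distinct levels, the glueing (2.141),
d(y, y′) across levels) is NOT touched: it remains the DAG hypothesis `…B6.Prop26Printed` downstream (`DagBinding`,
`B9FromB6`), exactly as for the one-scale model instances of Prop. 2.2 (`B6Prop22BoxFamily` p249487,
`B6Prop22OneScaleTorus` p258648) and Prop. 2.3 (`B6Prop23OneScaleTorus` p253194, `B6QGQCoerciveTowerTorus` p263803) —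
census standard G.1 «model instance, no analytic hypothesis».  Value = the census Prop of B6's «main technical result»
inhabited on a genuine family by [4]'s theorem; NOT summit progress.
-/

namespace Literature.MathematicalPhysics.QuantumFieldTheory.Balaban1983to89.B6Prop26OneScaleFromB5

open Literature.MathematicalPhysics.QuantumFieldTheory.Balaban1983to89.B6 (Geometry GFamily Ineq2136_2140 Prop26Printed pref4 pref6)

noncomputable section

/-! ## §1  Dictionary: a `B5.Setting` as a one-level `B6.Geometry` -/

section Generic

variable (S : B5.Setting) [Fintype S.Site] (dist : S.Site → S.Site → ℝ) (L : ℝ) (K : ℕ) (M : ℝ)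

/-- the ONE-LEVEL B6 geometry of a B5 setting: every site at scale `K`, `η = (L^K)⁻¹` (so `L^Kη = 1`, [4]'s unit
lattice), (2.1)–(2.2) void (`Hyp21_22 := True`), `R := 1`, cube-size parameter `M`, the distance `dist`, and [4]'s
test-function / cut-off data. [cite: Balaban1984PropagatorsII, (2.1)–(2.4) p.224; Balaban1984PropagatorsI, Prop. 1.2 p.35] -/
def geoOf : Geometry where
  Site := S.Site
  fin := inferInstance
  scale := fun _ => K
  dist := dist
  k := K
  eta := (L ^ K)⁻¹
  L := L
  R := 1
  M := M
  Hyp21_22 := True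
  Loc := S.Loc
  suppIn := S.suppIn
  supNorm := S.supNorm
  l2Norm := S.l2Norm
  holder := S.holder
  Cut := S.Cut
  cutIn := S.cutIn
  cutH := S.cutH
  cutSup := S.cutSup

/-- [4]'s Prop. 1.2 functionals of `G` read as the (2.136)–(2.140) functionals of B6 Prop. 2.6.
[cite: Balaban1984PropagatorsII, (2.136)–(2.140) p.247; Balaban1984PropagatorsI, (1.110)–(1.114) pp.35–36] -/
def gOf : GFamily (geoOf S dist L K M) where
  e := S.e
  h1 := S.h1
  e4 := S.e4
  h2 := S.h2
  l2 := S.l2loc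

variable {S dist L K M}

/-- one level: `L^jη = L^K·(L^K)⁻¹ = 1`. [cite: Balaban1984PropagatorsII, (2.1) p.224] -/
theorem len_geoOf (hL : L ≠ 0) (y : S.Site) : (geoOf S dist L K M).len y = 1 := by
  show L ^ K * (L ^ K)⁻¹ = 1
  exact mul_inv_cancel₀ (pow_ne_zero K hL)

/-- the prefactor table (2.136) at `L^jη = 1`. [cite: Balaban1984PropagatorsII, (2.136) p.247] -/
theorem pref4_one (n : Fin 4) : pref4 1 n = 1 := by
  fin_cases n <;> simp [pref4]

/-- the prefactor table (2.140) at `L^jη = 1`. [cite: Balaban1984PropagatorsII, (2.140) p.247] -/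
theorem pref6_one (n : Fin 6) : pref6 1 n = 1 := by
  fin_cases n <;> simp [pref6]

/-- the exponential transfer: `dist ≤ κ·dist′` and `δ ≥ 0` give `e^{−δ·dist′} ≤ e^{−(δ/κ)·dist}`. [folklore] -/
private theorem exp_transfer {κ δ t t' : ℝ} (hκ : 0 < κ) (hδ : 0 ≤ δ) (h : t ≤ κ * t') :
    Real.exp (-(δ * t')) ≤ Real.exp (-(δ / κ * t)) := by
  apply Real.exp_le_exp.mpr
  have h1 : δ / κ * t ≤ δ / κ * (κ * t') := mul_le_mul_of_nonneg_left h (div_nonneg hδ hκ.le)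
  have h2 : δ / κ * (κ * t') = δ * t' := by field_simp
  linarith

/-- monotone bookkeeping: `A ≤ c·E₀·X`, `c ≤ c⁺`, `0 ≤ c⁺`, `E₀ ≤ E₁`, `0 ≤ E₀`, `0 ≤ X` give `A ≤ c⁺·E₁·X`. [folklore] -/
private theorem mono3 {A c c' E₀ E₁ X : ℝ} (hA : A ≤ c * E₀ * X) (hc : c ≤ c') (hc' : 0 ≤ c') (hE : E₀ ≤ E₁)
    (hE₀ : 0 ≤ E₀) (hX : 0 ≤ X) : A ≤ c' * E₁ * X := by
  have h1 : c * E₀ * X ≤ c' * E₀ * X := mul_le_mul_of_nonneg_right (mul_le_mul_of_nonneg_right hc hE₀) hX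
  have h2 : c' * E₀ * X ≤ c' * E₁ * X := mul_le_mul_of_nonneg_right (mul_le_mul_of_nonneg_left hE hc') hX
  linarith

/-- **THE DICTIONARY**: [4]'s (1.110)–(1.114) for the functionals of `S` ⟹ B6's (2.136)–(2.140) for the one-level
geometry with any distance `dist ≤ κ·|y−y′|`, rate `δ₀/κ`, constants `O(1)`, `max(O(1)(·), 0)`.
[cite: Balaban1984PropagatorsII, Prop. 2.6 (2.136)–(2.140) p.247; Balaban1984PropagatorsI, Prop. 1.2 (1.110)–(1.114) pp.35–36] -/
theorem ineq2136_of_ineq110 (hL : L ≠ 0) {κ : ℝ} (hκ : 0 < κ) (hdist : ∀ y y', dist y y' ≤ κ * S.dist y y')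
    (hsup : ∀ J, 0 ≤ S.supNorm J) (hcutH : ∀ α ζ, 0 ≤ S.cutH α ζ) (hhol : ∀ ε J, 0 ≤ S.holder ε J)
    (hcutSup : ∀ ζ, 0 ≤ S.cutSup ζ) (hl2 : ∀ J, 0 ≤ S.l2Norm J)
    {C : ℝ} {Cα Cε : ℝ → ℝ} {Cαε : ℝ → ℝ → ℝ} {δ₀ : ℝ} (hC : 0 ≤ C) (hδ₀ : 0 ≤ δ₀)
    (h : B5.Ineq110_114 S C Cα Cε Cαε δ₀) :
    Ineq2136_2140 (gOf S dist L K M) C (fun α => max (Cα α) 0) (fun ε => max (Cε ε) 0)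
      (fun α ε => max (Cαε α ε) 0) (δ₀ / κ) := by
  obtain ⟨h1, h2, h3, h4, h5⟩ := h
  have hE : ∀ y y' : S.Site,
      Real.exp (-(δ₀ * S.dist y y')) ≤ Real.exp (-(δ₀ / κ * dist y y')) :=
    fun y y' => exp_transfer hκ hδ₀ (hdist y y')
  have hE0 : ∀ y y' : S.Site, 0 ≤ Real.exp (-(δ₀ * S.dist y y')) := fun _ _ => Real.exp_nonneg _
  refine ⟨?_, ?_, ?_, ?_, ?_⟩
  · -- (2.136) ⇐ (1.110)
    intro n J y y' hJ
    have hlen : (geoOf S dist L K M).len y = 1 := len_geoOf hL y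
    show S.e n J y ≤ C * pref4 ((geoOf S dist L K M).len y) n * Real.exp (-(δ₀ / κ * dist y y')) * S.supNorm J
    rw [hlen, pref4_one, mul_one]
    exact mono3 (h1 n J y y' hJ) le_rfl hC (hE y y') (hE0 y y') (hsup J)
  · -- (2.137) ⇐ (1.111)
    intro α J ζ y y' hα0 hα1 hζ hJ
    have hlen : (geoOf S dist L K M).len y = 1 := len_geoOf hL y
    show S.h1 J α ζ ≤ max (Cα α) 0 * (geoOf S dist L K M).len y ^ (1 - α) * S.cutH α ζ *
      Real.exp (-(δ₀ / κ * dist y y')) * S.supNorm J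
    rw [hlen, Real.one_rpow, mul_one]
    have h0 := h2 α J ζ y y' hα0 hα1 hζ hJ
    have hX : 0 ≤ S.cutH α ζ * S.supNorm J := mul_nonneg (hcutH α ζ) (hsup J)
    have h' : S.h1 J α ζ ≤ Cα α * Real.exp (-(δ₀ * S.dist y y')) * (S.cutH α ζ * S.supNorm J) := by
      rw [← mul_assoc]; exact h0
    have := mono3 h' (le_max_left (Cα α) 0) (le_max_right _ _) (hE y y') (hE0 y y') hX
    calc S.h1 J α ζ ≤ max (Cα α) 0 * Real.exp (-(δ₀ / κ * dist y y')) * (S.cutH α ζ * S.supNorm J) := this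
      _ = max (Cα α) 0 * S.cutH α ζ * Real.exp (-(δ₀ / κ * dist y y')) * S.supNorm J := by ring
  · -- (2.138) ⇐ (1.112)
    intro ε J y y' hε0 hε1 hJ
    show S.e4 J y ≤ max (Cε ε) 0 * Real.exp (-(δ₀ / κ * dist y y')) * (S.holder ε J + S.supNorm J)
    exact mono3 (h3 ε J y y' hε0 hε1 hJ) (le_max_left _ _) (le_max_right _ _) (hE y y') (hE0 y y')
      (add_nonneg (hhol ε J) (hsup J))
  · -- (2.139) ⇐ (1.113)
    intro α ε J ζ y y' hα0 hε0 hαε hζ hJ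
    have hlen : (geoOf S dist L K M).len y = 1 := len_geoOf hL y
    show S.h2 J α ζ ≤ max (Cαε α ε) 0 * (geoOf S dist L K M).len y ^ (-α) * S.cutH α ζ *
      Real.exp (-(δ₀ / κ * dist y y')) * (S.holder (α + ε) J + S.supNorm J)
    rw [hlen, Real.one_rpow, mul_one]
    have h0 := h4 α ε J ζ y y' hα0 hε0 hαε hζ hJ
    have hX : 0 ≤ S.cutH α ζ * (S.holder (α + ε) J + S.supNorm J) :=
      mul_nonneg (hcutH α ζ) (add_nonneg (hhol _ J) (hsup J))
    have h' : S.h2 J α ζ ≤ Cαε α ε * Real.exp (-(δ₀ * S.dist y y')) *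
        (S.cutH α ζ * (S.holder (α + ε) J + S.supNorm J)) := by
      rw [← mul_assoc]; exact h0
    have := mono3 h' (le_max_left (Cαε α ε) 0) (le_max_right _ _) (hE y y') (hE0 y y') hX
    calc S.h2 J α ζ ≤ max (Cαε α ε) 0 * Real.exp (-(δ₀ / κ * dist y y')) *
          (S.cutH α ζ * (S.holder (α + ε) J + S.supNorm J)) := this
      _ = max (Cαε α ε) 0 * S.cutH α ζ * Real.exp (-(δ₀ / κ * dist y y')) *
          (S.holder (α + ε) J + S.supNorm J) := by ring
  · -- (2.140) ⇐ (1.114)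
    intro n J ζ y y' hζ hJ
    have hlen : (geoOf S dist L K M).len y = 1 := len_geoOf hL y
    show S.l2loc n J ζ ≤ C * pref6 ((geoOf S dist L K M).len y) n * S.cutSup ζ *
      Real.exp (-(δ₀ / κ * dist y y')) * S.l2Norm J
    rw [hlen, pref6_one, mul_one]
    have h0 := h5 n J ζ y y' hζ hJ
    have hX : 0 ≤ S.cutSup ζ * S.l2Norm J := mul_nonneg (hcutSup ζ) (hl2 J)
    have h' : S.l2loc n J ζ ≤ C * Real.exp (-(δ₀ * S.dist y y')) * (S.cutSup ζ * S.l2Norm J) := by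
      rw [← mul_assoc]; exact h0
    have := mono3 h' le_rfl hC (hE y y') (hE0 y y') hX
    calc S.l2loc n J ζ ≤ C * Real.exp (-(δ₀ / κ * dist y y')) * (S.cutSup ζ * S.l2Norm J) := this
      _ = C * S.cutSup ζ * Real.exp (-(δ₀ / κ * dist y y')) * S.l2Norm J := by ring

end Generic

/-- **[4] Prop. 1.2 for a family ⟹ (2.136)–(2.140) for EVERY one-level member, family-uniform constants**
(`δ₃ = δ₀/κ`, `O(1)`, `max(O(1)(·), 0)`). [cite: Balaban1984PropagatorsII, Prop. 2.6 (2.136)–(2.140) p.247; Balaban1984PropagatorsI, Prop. 1.2 pp.35–36] -/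
theorem ineq2136_fam_of_prop12Printed {I : Type} (fam : I → B5.Setting) [∀ i, Fintype (fam i).Site]
    (dist : ∀ i, (fam i).Site → (fam i).Site → ℝ) (L : ℝ) (hL : L ≠ 0) (K : I → ℕ) (M : ℝ) {κ : ℝ} (hκ : 0 < κ)
    (hdist : ∀ i y y', dist i y y' ≤ κ * (fam i).dist y y')
    (hsup : ∀ i J, 0 ≤ (fam i).supNorm J) (hcutH : ∀ i α ζ, 0 ≤ (fam i).cutH α ζ)
    (hhol : ∀ i ε J, 0 ≤ (fam i).holder ε J) (hcutSup : ∀ i ζ, 0 ≤ (fam i).cutSup ζ)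
    (hl2 : ∀ i J, 0 ≤ (fam i).l2Norm J) (h : B5.Prop12Printed fam) :
    ∃ δ₃ C : ℝ, ∃ Cα Cε : ℝ → ℝ, ∃ Cαε : ℝ → ℝ → ℝ, 0 < δ₃ ∧ 0 < C ∧
      ∀ i, Ineq2136_2140 (gOf (fam i) (dist i) L (K i) M) C Cα Cε Cαε δ₃ := by
  obtain ⟨δ₀, C, Cα, Cε, Cαε, hδ₀, hC, hall⟩ := h
  exact ⟨δ₀ / κ, C, fun α => max (Cα α) 0, fun ε => max (Cε ε) 0, fun α ε => max (Cαε α ε) 0,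
    div_pos hδ₀ hκ, hC, fun i =>
      ineq2136_of_ineq110 hL hκ (hdist i) (hsup i) (hcutH i) (hhol i) (hcutSup i) (hl2 i) hC.le hδ₀.le (hall i)⟩

/-- **[4] Prop. 1.2 ⟹ B6 Prop. 2.6 on the one-level geometries of a family** (the guards `Hyp21_22`, `M₁ ≤ M` of the
verbatim typing are not even used: M₁ := 1). [cite: Balaban1984PropagatorsII, Prop. 2.6 p.247; Balaban1984PropagatorsI, Prop. 1.2 pp.35–36] -/
theorem prop26Printed_of_prop12Printed {I : Type} (fam : I → B5.Setting) [∀ i, Fintype (fam i).Site]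
    (dist : ∀ i, (fam i).Site → (fam i).Site → ℝ) (L : ℝ) (hL : L ≠ 0) (K : I → ℕ) (M : ℝ) {κ : ℝ} (hκ : 0 < κ)
    (hdist : ∀ i y y', dist i y y' ≤ κ * (fam i).dist y y')
    (hsup : ∀ i J, 0 ≤ (fam i).supNorm J) (hcutH : ∀ i α ζ, 0 ≤ (fam i).cutH α ζ)
    (hhol : ∀ i ε J, 0 ≤ (fam i).holder ε J) (hcutSup : ∀ i ζ, 0 ≤ (fam i).cutSup ζ)
    (hl2 : ∀ i J, 0 ≤ (fam i).l2Norm J) (h : B5.Prop12Printed fam) :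
    Prop26Printed (fun i => geoOf (fam i) (dist i) L (K i) M) (fun i => gOf (fam i) (dist i) L (K i) M) := by
  obtain ⟨δ₃, C, Cα, Cε, Cαε, hδ₃, hC, hall⟩ :=
    ineq2136_fam_of_prop12Printed fam dist L hL K M hκ hdist hsup hcutH hhol hcutSup hl2 h
  exact ⟨1, δ₃, C, Cα, Cε, Cαε, one_pos, hδ₃, hC, fun i _ _ => hall i⟩

/-! ## §2  The instance: [4]'s tori of record with `G = Δ_a⁻¹` -/

section Instance

open Literature.MathematicalPhysics.QuantumFieldTheory.Balaban1983to89.B5Prop11Plancherel (Tor)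
open Literature.MathematicalPhysics.QuantumFieldTheory.Balaban1983to89.B5Prop12FieldsLattice (distSite supNormL_nonneg holderL_nonneg cutSupL_nonneg
  cutHL_nonneg)
open Literature.MathematicalPhysics.QuantumFieldTheory.Balaban1983to89.B5Prop11SettingModel (locNorm_nonneg)
open Literature.MathematicalPhysics.QuantumFieldTheory.Balaban1983to89.B5SettingP12Weighted (sqEta_nonneg)
open Literature.MathematicalPhysics.QuantumFieldTheory.Balaban1983to89.B5SiteBridgeP12 (MP)
open Literature.MathematicalPhysics.QuantumFieldTheory.Balaban1983to89.B5ResidualGpTorusHolds (TopIdx)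
open Literature.MathematicalPhysics.QuantumFieldTheory.Balaban1983to89.B5Prop12GLattice (famG)

variable {d : ℕ} (N : Fin d → ℕ)

/-- **B6's distance at one level**: d(y, y′) of (2.46) for two points of the single Λ_K = T₁^{(K)} is the ℓ¹ length of
the shortest unit-lattice contour, i.e. the ℓ¹ circular distance `Σ_μ dist(y_μ − y′_μ, N_μℤ)` (p. 223: «l¹-norm»).
[cite: Balaban1984PropagatorsII, p.223, (2.46) p.231] -/
def dist1 (y y' : Tor N) : ℝ := ∑ μ, (((y μ - y' μ).valMinAbs.natAbs : ℕ) : ℝ)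

/-- ℓ¹ ≤ d·ℓ^∞ on the torus: `dist1 ≤ d · distSite` ([4]'s family uses the sup circular distance).
[cite: Balaban1984PropagatorsII, p.223; Balaban1984PropagatorsI, (1.110) p.35] -/
theorem dist1_le (y y' : Tor N) : dist1 N y y' ≤ (d : ℝ) * distSite N y y' := by
  unfold dist1 distSite
  have hle : ∀ μ ∈ (Finset.univ : Finset (Fin d)), (((y μ - y' μ).valMinAbs.natAbs : ℕ) : ℝ) ≤
      ((Finset.univ.sup fun μ => ((y μ - y' μ).valMinAbs).natAbs : ℕ) : ℝ) := by
    intro μ hμ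
    exact_mod_cast Finset.le_sup (f := fun μ => ((y μ - y' μ).valMinAbs).natAbs) hμ
  calc ∑ μ, (((y μ - y' μ).valMinAbs.natAbs : ℕ) : ℝ)
      ≤ ∑ _μ : Fin d, ((Finset.univ.sup fun μ => ((y μ - y' μ).valMinAbs).natAbs : ℕ) : ℝ) :=
        Finset.sum_le_sum hle
    _ = (d : ℝ) * ((Finset.univ.sup fun μ => ((y μ - y' μ).valMinAbs).natAbs : ℕ) : ℝ) := by
        rw [Finset.sum_const, Finset.card_univ, Fintype.card_fin, nsmul_eq_mul]

variable (d) (L : ℕ) (a : ℝ)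

/-- the finite site type of a member of the family of record (`Tor (MP P)`). [cite: Balaban1984PropagatorsI, Prop. 1.2 p.35] -/
instance fintypeSite_famG (i : TopIdx d L) : Fintype (famG d L a i).Site :=
  show Fintype (Tor (MP i.P)) from inferInstance

/-- **the one-level B6 geometries of [4]'s tori of record**: member `i` = the torus `T₁^{(K)}` of `i.P` (every volume,
every `K ≥ 1`), all sites at scale `K`, `η = L^{−K}`, ℓ¹ distance, `M = 1`. [cite: Balaban1984PropagatorsII, (2.1)–(2.4) p.224, Prop. 2.6 p.247] -/
def geoFam (i : TopIdx d L) : Geometry := geoOf (famG d L a i) (dist1 (MP i.P)) (L : ℝ) i.P.K 1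

/-- the (2.136)–(2.140) functionals of `G = Δ_a⁻¹` on member `i` = [4]'s (1.110)–(1.114) functionals
(`B5Prop12FieldsLattice.eL/h1L/e4L/h2L/l2locL`). [cite: Balaban1984PropagatorsII, (2.136)–(2.140) p.247] -/
def GFam (i : TopIdx d L) : GFamily (geoFam d L a i) := gOf (famG d L a i) (dist1 (MP i.P)) (L : ℝ) i.P.K 1

variable {d L a}

/-- the six located inputs of the dictionary for the family of record: ℓ¹ ≤ d·sup and the non-negativity of [4]'s
norm functionals `|J|`, `‖ζ‖_α + |ζ|`, `‖J‖_ε`, `|ζ|`, `‖J‖`. [cite: Balaban1984PropagatorsI, (1.108)–(1.109) p.35] -/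
theorem inputs_famG (hd : 1 ≤ d) :
    (∀ (i : TopIdx d L) y y', dist1 (MP i.P) y y' ≤ (d : ℝ) * (famG d L a i).dist y y') ∧
    (∀ (i : TopIdx d L) J, 0 ≤ (famG d L a i).supNorm J) ∧
    (∀ (i : TopIdx d L) α ζ, 0 ≤ (famG d L a i).cutH α ζ) ∧
    (∀ (i : TopIdx d L) ε J, 0 ≤ (famG d L a i).holder ε J) ∧
    (∀ (i : TopIdx d L) ζ, 0 ≤ (famG d L a i).cutSup ζ) ∧
    (∀ (i : TopIdx d L) J, 0 ≤ (famG d L a i).l2Norm J) := by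
  have _ := hd
  refine ⟨?_, fun i J => supNormL_nonneg _, fun i α ζ => cutHL_nonneg _ _, fun i ε J => holderL_nonneg _ _,
    fun i ζ => cutSupL_nonneg _, fun i J => mul_nonneg (sqEta_nonneg _ _) (locNorm_nonneg _)⟩
  intro i y y'
  have h := dist1_le (MP i.P) y y'
  have hdd : ((i.P.d : ℕ) : ℝ) = (d : ℝ) := by rw [i.hPd]
  rw [hdd] at h
  exact h

/-- **(2.136)–(2.140) FOR EVERY MEMBER OF THE ONE-LEVEL SUB-FAMILY, family-uniform constants, NO hypothesis** (every
`d ≥ 1`, odd `L > 1`, `a > 0`; `δ₃ = δ₀/d` with [4]'s `δ₀`). [cite: Balaban1984PropagatorsII, Prop. 2.6 (2.136)–(2.140) p.247; Balaban1984PropagatorsI, Prop. 1.2 pp.35–36] -/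
theorem ineq2136_2140_famG (hd : 1 ≤ d) (hL : Odd L ∧ 1 < L) (ha : 0 < a) :
    ∃ δ₃ C : ℝ, ∃ Cα Cε : ℝ → ℝ, ∃ Cαε : ℝ → ℝ → ℝ, 0 < δ₃ ∧ 0 < C ∧
      ∀ i : TopIdx d L, Ineq2136_2140 (GFam d L a i) C Cα Cε Cαε δ₃ := by
  have hL0 : (L : ℝ) ≠ 0 := by exact_mod_cast (show L ≠ 0 by omega)
  have hd0 : (0 : ℝ) < d := by exact_mod_cast hd
  obtain ⟨h1, h2, h3, h4, h5, h6⟩ := inputs_famG (L := L) (a := a) hd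
  exact ineq2136_fam_of_prop12Printed (famG d L a) (fun i => dist1 (MP i.P)) (L : ℝ) hL0 (fun i => i.P.K) 1 hd0
    h1 h2 h3 h4 h5 h6 (B5Prop12GHolds.prop12_famG_printed hd hL ha)

/-- **PROPOSITION 2.6 ON THE ONE-LEVEL SUB-FAMILY, HYPOTHESIS-FREE** (every `d ≥ 1`, odd `L > 1`, `a > 0`): the verbatim
`B6.Prop26Printed` holds for the one-level geometries of [4]'s tori of record with `G = Δ_a⁻¹`, `δ₃ = δ₀/d`, by [4]'s
Proposition 1.2 (p37 `B5Prop12GHolds.prop12_famG_printed`). [cite: Balaban1984PropagatorsII, Prop. 2.6 (2.136)–(2.140) p.247; Balaban1984PropagatorsI, Prop. 1.2 pp.35–36] -/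
theorem prop26Printed_famG (hd : 1 ≤ d) (hL : Odd L ∧ 1 < L) (ha : 0 < a) :
    Prop26Printed (geoFam d L a) (GFam d L a) := by
  have hL0 : (L : ℝ) ≠ 0 := by exact_mod_cast (show L ≠ 0 by omega)
  have hd0 : (0 : ℝ) < d := by exact_mod_cast hd
  obtain ⟨h1, h2, h3, h4, h5, h6⟩ := inputs_famG (L := L) (a := a) hd
  exact prop26Printed_of_prop12Printed (famG d L a) (fun i => dist1 (MP i.P)) (L : ℝ) hL0 (fun i => i.P.K) 1 hd0
    h1 h2 h3 h4 h5 h6 (B5Prop12GHolds.prop12_famG_printed hd hL ha)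

/-- NON-VACUITY (i): every member meets the guards of the verbatim typing — (2.1)–(2.2) are void at one level and
`M = 1 ≥ M₁ = 1`; and `L^jη = 1` on every member. [cite: Balaban1984PropagatorsII, (2.1)–(2.2) p.224, Prop. 2.6 p.247] -/
theorem guards_geoFam (i : TopIdx d L) :
    (geoFam d L a i).Hyp21_22 ∧ (1 : ℝ) ≤ (geoFam d L a i).M ∧
      ((L : ℝ) ≠ 0 → ∀ y, (geoFam d L a i).len y = 1) :=
  ⟨trivial, le_rfl, fun hL y => len_geoOf hL y⟩

/-- NON-VACUITY (ii): the index type is inhabited for every `d ≥ 1`, odd `L > 1` (e.g. `m = 0`, `K = 1`).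
[cite: Balaban1984PropagatorsI, Prop. 1.2 p.35 («for arbitrary T_η»)] -/
theorem topIdx_nonempty (hd : 1 ≤ d) (hL : Odd L ∧ 1 < L) : Nonempty (TopIdx d L) :=
  ⟨⟨⟨d, L, 0, 1, hd, hL⟩, rfl, rfl, le_rfl⟩⟩

end Instance

end

end Literature.MathematicalPhysics.QuantumFieldTheory.Balaban1983to89.B6Prop26OneScaleFromB5
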